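import Literature.Probability.RandomPlanarGeometry.HexSAWBrickWallStrip
import Literature.Probability.RandomPlanarGeometry.HexSAWStrip
import HarnessLib

/-!
# The dictionary between row strips of the brick wall and the strips of Duminil-Copin–Smirnov:
# `S_T = ℤ × {0,…,T}` is the set of vertices of levels `0, …, 2(T+1) − 1`

Topic `Literature/Probability/RandomPlanarGeometry` (continues `HexSAWBrickWallStrip.lean` — the row strips
`HexBW.InStrip T` of the brick wall `brickWallGraph` (= the honeycomb lattice, `bwIso : brickWallGraph ≃g hvGraph` of
`SAWBrickWallHex.lean`) and their connective constants `HexBW.stripConnectiveConstant T` — and `HexSAWStrip.lean` —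
Duminil-Copin–Smirnov's level `HV.lev v = 2 x₁ + b` on the coordinate model `hvGraph` of `ℍ`, "every edge joins
consecutive levels", and their strip domains `S_T` = the vertices of levels `0, …, 2T − 1` (`HV.stripV T L`, cut at `±L`)).
Sources: H. Duminil-Copin, S. Smirnov, *The connective constant of the honeycomb lattice equals `√(2+√2)`*, Ann. of
Math. 175 (2012), §3 ("We consider a vertical strip domain `S_T` composed of `T` strips of hexagons");
I. G. Enting, I. Jensen, LNP 775 (2009), §7.4.2, Fig. 7.10 (the brickwork form of the honeycomb lattice).

## What is proved

The tree's isomorphism `bwIso` sends the brick-wall site `(x, y)` to a vertex of level `y − x`, so it maps the ROW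
strips of the brick wall to DIAGONAL bands of levels, not to the strips of Duminil-Copin–Smirnov.  This file
supplies the other identification — the composition of `bwIso` with a rotation of `ℍ`, written directly in coordinates:

  `rowIso : brickWallGraph ≃g hvGraph`,  `(x, y) ↦ ((x − y + (x + y) mod 2)/2, y, [x + y even])`,

under which the ROW `y` of the brick wall becomes the pair of levels `{2y, 2y + 1}` (`lev_rowIso`: the sites of odd
parity, whose vertical bond points down, go to the even level `2y`; the sites of even parity to `2y + 1`).  Hence

  `inStrip_iff_lev_rowIso : InStrip T v ↔ 0 ≤ lev (rowIso v) ≤ 2(T + 1) − 1`,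

i.e. the row strip `S_T` of `HexSAWBrickWallStrip.lean` (`T + 1` rows of sites) IS, as an induced subgraph of `ℍ`,
the infinite strip of Duminil-Copin–Smirnov with `T + 1` strips of hexagons in the tree's level convention
(`HexSAWStrip.lean`: `S_{T'}` = levels `0, …, 2T' − 1`, here `T' = T + 1`).  Consequently the strip connective constant
`HexBW.stripConnectiveConstant T` and the locality rate of `HexSAWBrickWallStripLocality.lean` are statements about the
Duminil-Copin–Smirnov strips `S_{T+1}` (the lane's numerics of record for honeycomb strips are indexed by `T'`).

## Contents (namespace `Literature.Probability.RandomPlanarGeometry.SAW.HexBW`, all PROVED)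

* `rowToHV`, `hvToRow`, `rowEquiv`, `adj_rowToHV_iff`, **`rowIso : brickWallGraph ≃g hvGraph`**;
* **`lev_rowIso`** — `lev (rowIso (x, y)) = 2y + 1 − (x + y) mod 2`;
* **`inStrip_iff_lev_rowIso`** — `InStrip T v ↔ 0 ≤ lev (rowIso v) ∧ lev (rowIso v) ≤ 2T + 1`;
* `rowIso_symm_mem_strip_iff` — the same read from the `ℍ` side: a vertex `w` of `ℍ` lies over `S_T` iff
  `0 ≤ lev w ≤ 2T + 1`.
-/

noncomputable section

open Literature.Probability.LatticeModels Literature.Probability.Percolation SimpleGraph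

namespace Literature.Probability.RandomPlanarGeometry.SAW.HexBW

/-- The rotated identification of the brick wall with the coordinate model of `ℍ`:
`(x, y) ↦ ((x − y + (x + y) mod 2)/2, y, [x + y even])`. [cite: EntingJensen2009, §7.4.2, Fig. 7.10 (brickwork form of the honeycomb lattice)] -/
def rowToHV (v : Site 2) : HV :=
  ((v 0 - v 1 + (v 0 + v 1) % 2) / 2, v 1, decide ((v 0 + v 1) % 2 = 0))

/-- The inverse map: `(a, b, up) ↦ (2a + b, b)`, `(a, b, down) ↦ (2a + b − 1, b)`. [cite: EntingJensen2009, §7.4.2, Fig. 7.10 (brickwork form of the honeycomb lattice)] -/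
def hvToRow (w : HV) : Site 2 :=
  fun i => if i = 0 then (if w.2.2 then 2 * w.1 + w.2.1 else 2 * w.1 + w.2.1 - 1) else w.2.1

/-- Coordinates of `hvToRow`. [cite: EntingJensen2009, §7.4.2, Fig. 7.10 (brickwork form of the honeycomb lattice)] -/
@[simp] theorem hvToRow_apply_zero (w : HV) :
    hvToRow w 0 = if w.2.2 then 2 * w.1 + w.2.1 else 2 * w.1 + w.2.1 - 1 := rfl

/-- Coordinates of `hvToRow`. [cite: EntingJensen2009, §7.4.2, Fig. 7.10 (brickwork form of the honeycomb lattice)] -/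
@[simp] theorem hvToRow_apply_one (w : HV) : hvToRow w 1 = w.2.1 := if_neg (by decide)

/-- `hvToRow` is a left inverse of `rowToHV`. [cite: EntingJensen2009, §7.4.2, Fig. 7.10 (brickwork form of the honeycomb lattice)] -/
theorem hvToRow_rowToHV (v : Site 2) : hvToRow (rowToHV v) = v := by
  funext i
  fin_cases i
  · simp only [Fin.zero_eta, hvToRow_apply_zero, rowToHV, decide_eq_true_eq]
    split_ifs with h <;> omega
  · simp [rowToHV]

/-- `hvToRow` is a right inverse of `rowToHV`. [cite: EntingJensen2009, §7.4.2, Fig. 7.10 (brickwork form of the honeycomb lattice)] -/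
theorem rowToHV_hvToRow (w : HV) : rowToHV (hvToRow w) = w := by
  obtain ⟨a, b, c⟩ := w
  cases c
  · simp only [rowToHV, hvToRow_apply_zero, hvToRow_apply_one, Bool.false_eq_true, ↓reduceIte, Prod.mk.injEq]
    exact ⟨by omega, trivial, decide_eq_false (by omega)⟩
  · simp only [rowToHV, hvToRow_apply_zero, hvToRow_apply_one, ↓reduceIte, Prod.mk.injEq]
    exact ⟨by omega, trivial, decide_eq_true (by omega)⟩

/-- The underlying bijection `ℤ² ≃ HV` of `rowIso`. [cite: EntingJensen2009, §7.4.2, Fig. 7.10 (brickwork form of the honeycomb lattice)] -/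
def rowEquiv : Site 2 ≃ HV := ⟨rowToHV, hvToRow, hvToRow_rowToHV, rowToHV_hvToRow⟩

/-- **`rowToHV` carries brick-wall bonds to the edges of `ℍ` and conversely.**
[cite: EntingJensen2009, §7.4.2, Fig. 7.10 (brickwork form of the honeycomb lattice)] -/
theorem adj_rowToHV_iff (p q : Site 2) : hvGraph.Adj (rowToHV p) (rowToHV q) ↔ brickWallGraph.Adj p q := by
  rw [hvGraph_adj, HV.AdjRel, brickWallGraph_adj_coord]
  simp only [rowToHV, decide_eq_true_eq, decide_eq_false_iff_not]
  omega

/-- **The brick wall is the honeycomb lattice, rows to levels**: the graph isomorphism `rowIso : brickWallGraph ≃g hvGraph`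
sending the row `y` to the levels `{2y, 2y + 1}`. [cite: EntingJensen2009, §7.4.2, Fig. 7.10 (brickwork form of the honeycomb lattice)] -/
def rowIso : brickWallGraph ≃g hvGraph where
  toEquiv := rowEquiv
  map_rel_iff' := fun {p q} => adj_rowToHV_iff p q

/-- `rowIso` is `rowToHV` on vertices. [cite: EntingJensen2009, §7.4.2, Fig. 7.10 (brickwork form of the honeycomb lattice)] -/
@[simp] theorem rowIso_apply (v : Site 2) : rowIso v = rowToHV v := rfl

/-- `rowIso.symm` is `hvToRow` on vertices. [cite: EntingJensen2009, §7.4.2, Fig. 7.10 (brickwork form of the honeycomb lattice)] -/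
@[simp] theorem rowIso_symm_apply (w : HV) : rowIso.symm w = hvToRow w := rfl

/-- **Rows are pairs of levels**: `lev (rowIso (x, y)) = 2y + 1 − (x + y) mod 2` — the sites of odd parity of the row
`y` (vertical bond downwards) sit at the even level `2y`, those of even parity at the odd level `2y + 1`.
[cite: DuminilCopinSmirnov2012, §3 (Fig. 3: the levels of S_T)] -/
theorem lev_rowIso (v : Site 2) : HV.lev (rowIso v) = 2 * v 1 + 1 - (v 0 + v 1) % 2 := by
  rw [rowIso_apply, rowToHV, HV.lev_mk]
  by_cases h : (v 0 + v 1) % 2 = 0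
  · rw [decide_eq_true h, HV.bit_true]
    omega
  · rw [decide_eq_false h, HV.bit_false]
    omega

/-- **The row strip `S_T` is the Duminil-Copin–Smirnov strip with `T + 1` strips of hexagons**:
`(x, y) ∈ S_T` iff `rowIso (x, y)` has level in `{0, …, 2(T+1) − 1}` (the level range of `HV.stripV (T+1) L`).
[cite: DuminilCopinSmirnov2012, §3 (the strip domains S_T)] -/
theorem inStrip_iff_lev_rowIso (T : ℕ) (v : Site 2) :
    InStrip T v ↔ 0 ≤ HV.lev (rowIso v) ∧ HV.lev (rowIso v) ≤ 2 * (T : ℤ) + 1 := by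
  rw [lev_rowIso, InStrip]
  omega

/-- The same from the `ℍ` side: a vertex `w` of the coordinate model lies over the row strip `S_T` iff its level is
in `{0, …, 2T + 1}`. [cite: DuminilCopinSmirnov2012, §3 (the strip domains S_T)] -/
theorem rowIso_symm_mem_strip_iff (T : ℕ) (w : HV) :
    InStrip T (rowIso.symm w) ↔ 0 ≤ HV.lev w ∧ HV.lev w ≤ 2 * (T : ℤ) + 1 := by
  have h := inStrip_iff_lev_rowIso T (rowIso.symm w)
  rwa [RelIso.apply_symm_apply] at h

end Literature.Probability.RandomPlanarGeometry.SAW.HexBW
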